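import Mathlib
import HarnessLib
import Literature.MathematicalPhysics.QuantumFieldTheory.ConstructiveQFTWave0Proofs
import Summits.Ventures.LatticeQCDFlow.Scaling.AbelianHolonomyDetermination
import Summits.Ventures.LatticeQCDFlow.Scaling.SliceTwistWitness

/-!
# LatticeQCDFlow / Scaling — coordinate-seam configurations: plaquette holonomy = a group COMMUTATOR;
# the two-seam configuration is flat off one stack of plaquettes and carries `[a, b] = a b a⁻¹ b⁻¹` on it

HONEST FRAMING: exact (Metropolis-corrected) sampling algorithms for lattice gauge theory;
figures of merit are autocorrelation/cost numbers at stated couplings and volumes; no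
continuum-physics claim.

Venture `LatticeQCDFlow` (cell pub-lqcd), topic `Scaling`, FANOUT row 30 (lean-1, GEN-28) — OUR WORK on
THEORY-2.md §4 row C5 (gen25 Q2), the NON-ABELIAN side.  `Scaling/AbelianHolonomyDetermination` proved that
for a COMMUTATIVE gauge group all plaquette holonomies of `(ℤ/L)^d` multiply to `1`
(`prod_plaquetteHolonomy_univ_eq_one`), so any one of them is the inverse product of the others
(`plaquetteHolonomy_eq_inv_prod_erase_anyDim`), and along a full ranked structure the covered holonomies
determine everything.  For a NON-commutative `G` the first identity already fails, explicitly: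

* §1 **`plaquetteHolonomy_coordinatewise`** — a COORDINATE-SEAM configuration `U(x, m) = ψ_m(x_m)` (each link
  variable depends only on the coordinate of its own direction) has holonomy the group commutator
  `U_{(x; k<l)} = [ψ_k(x_k), ψ_l(x_l)] := ψ_k(x_k) ψ_l(x_l) ψ_k(x_k)⁻¹ ψ_l(x_l)⁻¹` (the shifted sites `x + e_k`,
  `x + e_l` have the same `l`-th resp. `k`-th coordinate as `x`, `WilsonRP.shift_apply_of_ne`); for commutative `G` every such
  configuration is FLAT (**`plaquetteHolonomy_coordinatewise_eq_one_of_comm`**);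
* §2 THE TWO-SEAM CONFIGURATION `V_{a,b}`: `ψ_i(t) = a` if `t = c_i` else `1`, `ψ_j(t) = b` if `t = c_j` else `1`,
  all other `ψ_m ≡ 1` (`i < j`): **`plaquetteHolonomy_twoSeam`** — holonomy `[a, b] = a b a⁻¹ b⁻¹` around the plaquettes
  `(x; i<j)` of the STACK `x_i = c_i ∧ x_j = c_j` (`L^{d−2}` of them; ONE plaquette when `d = 2`) and `1`
  around every other plaquette of the torus;
* §3 consequences for ANY group with a non-commuting pair `a b ≠ b a` (`[a, b] ≠ 1`):
  **`exists_agree_off_stack_ne_on_stack`** — the trivial configuration and `V_{a,b}` have the same holonomy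
  (`= 1`) around every plaquette off the stack and holonomies `1 ≠ [a, b]` — NOT EVEN CONJUGATE — on it; so
  (**`not_determined_of_disjoint_stack`**) no collection `B` of plaquettes disjoint from a stack determines the
  holonomy, or the conjugacy class, or the value of a class function separating `[a, b]` from `1`, around a
  stack plaquette (**`not_determined_two_dim`**: on `(ℤ/L)^2` the stack through the base point of `p₀` is
  `{p₀}`, so NO `B ∌ p₀` determines `U_{p₀}`); and (**`exists_lone_plaquette_two_dim`**, `d = 2`) a
  configuration with holonomy `1` around every plaquette but `p₀` and `[a, b] ≠ 1` around `p₀` — the abelian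
  identity `∏_p U_p = 1` (no lone excited plaquette, **`no_lone_plaquette_of_comm`**, any `d`) has no
  non-commutative analogue.  (`d = 2`'s dichotomy «the other `L² − 1` plaquettes determine `U_{p₀}` ⇔ `G` is
  commutative» is `Scaling/TwoDimHolonomyDichotomy`.)

No `def` (configurations are explicit lambda terms), no `sorry`, nothing cited as a fact beyond the tree.
-/

namespace Summit.Ventures.LatticeQCDFlow.Theory2.Autoregressive

open Finset
open Literature.MathematicalPhysics.QuantumFieldTheory

variable {d L : ℕ} {G : Type*} [Group G]

/-! ## §1 Coordinate-seam configurations: holonomy is a commutator -/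

/-- `a b a⁻¹ b⁻¹ = 1 ↔ a b = b a`. [ours] -/
theorem mul_mul_inv_mul_inv_eq_one_iff (a b : G) : a * b * a⁻¹ * b⁻¹ = 1 ↔ a * b = b * a := by
  rw [mul_inv_eq_one, mul_inv_eq_iff_eq_mul]

/-- **A coordinate-seam configuration `U(x, m) = ψ_m(x_m)` has holonomy `[ψ_k(x_k), ψ_l(x_l)]` around
`(x; k, l)`, `k ≠ l`.** [ours] -/
theorem plaquetteHolonomy_coordinatewise (ψ : Fin d → ZMod L → G) (x : Site d L) {k l : Fin d}
    (hkl : k ≠ l) :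
    plaquetteHolonomy (fun e : Edge d L => ψ e.2 (e.1 e.2)) x k l = ψ k (x k) * ψ l (x l) * (ψ k (x k))⁻¹ * (ψ l (x l))⁻¹ := by
  rw [plaquetteHolonomy]
  simp only [WilsonRP.shift_apply_of_ne x (Ne.symm hkl), WilsonRP.shift_apply_of_ne x hkl]

/-- **For a commutative gauge group every coordinate-seam configuration is flat.** [ours] -/
theorem plaquetteHolonomy_coordinatewise_eq_one_of_comm (hcomm : ∀ g h : G, g * h = h * g)
    (ψ : Fin d → ZMod L → G) (x : Site d L) {k l : Fin d} (hkl : k ≠ l) :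
    plaquetteHolonomy (fun e : Edge d L => ψ e.2 (e.1 e.2)) x k l = 1 := by
  rw [plaquetteHolonomy_coordinatewise ψ x hkl, mul_mul_inv_mul_inv_eq_one_iff]
  exact hcomm _ _

/-- A plaquette of a coordinate-seam configuration whose two seam values commute — in particular if one of
them is `1` — has holonomy `1`. [ours] -/
theorem plaquetteHolonomy_coordinatewise_eq_one (ψ : Fin d → ZMod L → G) (x : Site d L) {k l : Fin d}
    (hkl : k ≠ l) (h : ψ k (x k) * ψ l (x l) = ψ l (x l) * ψ k (x k)) :
    plaquetteHolonomy (fun e : Edge d L => ψ e.2 (e.1 e.2)) x k l = 1 := by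
  rw [plaquetteHolonomy_coordinatewise ψ x hkl, mul_mul_inv_mul_inv_eq_one_iff]
  exact h

/-! ## §2 The two-seam configuration -/

/-- **THE TWO-SEAM CONFIGURATION.**  `i < j`; `a, b ∈ G`; seam positions `c_i, c_j ∈ ℤ/L`.  The configuration
`V(x, i) = a` if `x_i = c_i`, `V(x, j) = b` if `x_j = c_j`, all other link variables `1`, has holonomy `[a, b] = a b a⁻¹ b⁻¹`
around the plaquettes `(x; i<j)` with `x_i = c_i ∧ x_j = c_j` and `1` around every other plaquette. [ours] -/
theorem plaquetteHolonomy_twoSeam (a b : G) {i j : Fin d} (hij : i < j) (ci cj : ZMod L) (p : Plaquette d L) :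
    plaquetteHolonomy (fun e : Edge d L =>
        if e.2 = i then (if e.1 i = ci then a else 1) else if e.2 = j then (if e.1 j = cj then b else 1) else 1)
      p.1 p.2.1.1 p.2.1.2 =
      if p.2.1.1 = i ∧ p.2.1.2 = j ∧ p.1 i = ci ∧ p.1 j = cj then a * b * a⁻¹ * b⁻¹ else 1 := by
  obtain ⟨x, ⟨⟨k, l⟩, hkl⟩⟩ := p
  have hne : k ≠ l := ne_of_lt hkl
  have hij' : i ≠ j := ne_of_lt hij
  -- the configuration is coordinatewise with this `ψ`
  have hcfg : (fun e : Edge d L =>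
        if e.2 = i then (if e.1 i = ci then a else 1) else if e.2 = j then (if e.1 j = cj then b else 1) else 1) =
      fun e : Edge d L => (fun (m : Fin d) (t : ZMod L) =>
        if m = i then (if t = ci then a else 1) else if m = j then (if t = cj then b else 1) else (1 : G)) e.2 (e.1 e.2) := by
    funext e
    by_cases h1 : e.2 = i
    · simp [h1]
    · by_cases h2 : e.2 = j
      · simp [h2, hij'.symm]
      · simp [h1, h2]
  have key := plaquetteHolonomy_coordinatewise (L := L) (fun (m : Fin d) (t : ZMod L) =>
    if m = i then (if t = ci then a else 1) else if m = j then (if t = cj then b else 1) else (1 : G)) x hne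
  dsimp only
  rw [hcfg, key]
  by_cases hk : k = i
  · subst hk
    by_cases hl : l = j
    · subst hl
      simp only [if_true, hij'.symm, if_false, true_and]
      by_cases hα : x k = ci
      · by_cases hβ : x l = cj
        · simp [hα, hβ]
        · simp [hα, hβ]
      · simp [hα]
    · have hli : l ≠ k := hne.symm
      simp [hli, hl]
  · by_cases hkj : k = j
    · subst hkj
      have hli : l ≠ i := fun h => (lt_asymm hij) (h ▸ hkl)
      have hlj : l ≠ k := hne.symm
      simp [hli, hlj, hk]
    · simp [hk, hkj]

/-- Off the stack the two-seam configuration is flat. [ours] -/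
theorem plaquetteHolonomy_twoSeam_eq_one (a b : G) {i j : Fin d} (hij : i < j) (ci cj : ZMod L)
    (p : Plaquette d L) (hp : ¬ (p.2.1.1 = i ∧ p.2.1.2 = j ∧ p.1 i = ci ∧ p.1 j = cj)) :
    plaquetteHolonomy (fun e : Edge d L =>
        if e.2 = i then (if e.1 i = ci then a else 1) else if e.2 = j then (if e.1 j = cj then b else 1) else 1)
      p.1 p.2.1.1 p.2.1.2 = 1 := by
  rw [plaquetteHolonomy_twoSeam a b hij ci cj p, if_neg hp]

/-- On the stack the two-seam configuration has holonomy `[a, b]`. [ours] -/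
theorem plaquetteHolonomy_twoSeam_eq_commutator (a b : G) {i j : Fin d} (hij : i < j) (ci cj : ZMod L)
    (p : Plaquette d L) (hp : p.2.1.1 = i ∧ p.2.1.2 = j ∧ p.1 i = ci ∧ p.1 j = cj) :
    plaquetteHolonomy (fun e : Edge d L =>
        if e.2 = i then (if e.1 i = ci then a else 1) else if e.2 = j then (if e.1 j = cj then b else 1) else 1)
      p.1 p.2.1.1 p.2.1.2 = a * b * a⁻¹ * b⁻¹ := by
  rw [plaquetteHolonomy_twoSeam a b hij ci cj p, if_pos hp]

/-- The trivial configuration is flat. [ours] -/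
theorem plaquetteHolonomy_one_config_group (p : Plaquette d L) :
    plaquetteHolonomy (fun _ : Edge d L => (1 : G)) p.1 p.2.1.1 p.2.1.2 = 1 := by
  simp [plaquetteHolonomy]

/-! ## §3 Consequences for a non-commuting pair -/

/-- **The trivial configuration and the two-seam configuration agree (holonomy `1`) off the stack and carry
`1` resp. `[a, b]` on it.** [ours] -/
theorem exists_agree_off_stack_ne_on_stack (a b : G) {i j : Fin d} (hij : i < j) (ci cj : ZMod L) :
    ∃ U V : GaugeConfig d L G,
      (∀ p : Plaquette d L, ¬ (p.2.1.1 = i ∧ p.2.1.2 = j ∧ p.1 i = ci ∧ p.1 j = cj) →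
        plaquetteHolonomy U p.1 p.2.1.1 p.2.1.2 = plaquetteHolonomy V p.1 p.2.1.1 p.2.1.2) ∧
      (∀ p : Plaquette d L, (p.2.1.1 = i ∧ p.2.1.2 = j ∧ p.1 i = ci ∧ p.1 j = cj) →
        plaquetteHolonomy U p.1 p.2.1.1 p.2.1.2 = 1 ∧ plaquetteHolonomy V p.1 p.2.1.1 p.2.1.2 = a * b * a⁻¹ * b⁻¹) :=
  ⟨fun _ => 1, fun e : Edge d L =>
      if e.2 = i then (if e.1 i = ci then a else 1) else if e.2 = j then (if e.1 j = cj then b else 1) else 1,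
    fun p hp => by rw [plaquetteHolonomy_one_config_group, plaquetteHolonomy_twoSeam_eq_one a b hij ci cj p hp],
    fun p hp => ⟨plaquetteHolonomy_one_config_group p, plaquetteHolonomy_twoSeam_eq_commutator a b hij ci cj p hp⟩⟩

/-- `a b a⁻¹ b⁻¹ ≠ 1` for a non-commuting pair, and then it is not conjugate to `1`. [ours] -/
theorem commutator_ne_one_not_isConj {a b : G} (hab : a * b ≠ b * a) :
    a * b * a⁻¹ * b⁻¹ ≠ 1 ∧ ¬ IsConj (1 : G) (a * b * a⁻¹ * b⁻¹) := by
  have h : a * b * a⁻¹ * b⁻¹ ≠ 1 := fun h => hab ((mul_mul_inv_mul_inv_eq_one_iff a b).mp h)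
  exact ⟨h, fun hc => h (isConj_one_right.mp hc)⟩

/-- **NO COLLECTION OF PLAQUETTES DISJOINT FROM A STACK DETERMINES A STACK PLAQUETTE — not its holonomy, not
its conjugacy class, not the value of any class function separating `[a, b]` from `1`** (`G` any group with a
non-commuting pair `a b ≠ b a`; `i < j`; seams `c_i, c_j`; `B` disjoint from the stack; `p₀` on the stack):
two configurations with the same holonomy around every `p ∈ B`, holonomy `1` around `p₀` in one and the
non-conjugate `[a, b] ≠ 1` in the other. [ours] -/
theorem not_determined_of_disjoint_stack {a b : G} (hab : a * b ≠ b * a) {i j : Fin d} (hij : i < j)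
    (ci cj : ZMod L) (B : Finset (Plaquette d L))
    (hB : ∀ p ∈ B, ¬ (p.2.1.1 = i ∧ p.2.1.2 = j ∧ p.1 i = ci ∧ p.1 j = cj))
    (p₀ : Plaquette d L) (hp₀ : p₀.2.1.1 = i ∧ p₀.2.1.2 = j ∧ p₀.1 i = ci ∧ p₀.1 j = cj) :
    ∃ U V : GaugeConfig d L G,
      (∀ p ∈ B, plaquetteHolonomy U p.1 p.2.1.1 p.2.1.2 = plaquetteHolonomy V p.1 p.2.1.1 p.2.1.2) ∧
      plaquetteHolonomy U p₀.1 p₀.2.1.1 p₀.2.1.2 = 1 ∧ plaquetteHolonomy V p₀.1 p₀.2.1.1 p₀.2.1.2 ≠ 1 ∧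
      ¬ IsConj (plaquetteHolonomy U p₀.1 p₀.2.1.1 p₀.2.1.2) (plaquetteHolonomy V p₀.1 p₀.2.1.1 p₀.2.1.2) ∧
      ∀ w : G → ℝ, w (a * b * a⁻¹ * b⁻¹) ≠ w 1 →
        w (plaquetteHolonomy U p₀.1 p₀.2.1.1 p₀.2.1.2) ≠ w (plaquetteHolonomy V p₀.1 p₀.2.1.1 p₀.2.1.2) := by
  obtain ⟨U, V, hoff, hon⟩ := exists_agree_off_stack_ne_on_stack (L := L) a b hij ci cj
  obtain ⟨hU, hV⟩ := hon p₀ hp₀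
  obtain ⟨hne, hconj⟩ := commutator_ne_one_not_isConj hab
  refine ⟨U, V, fun p hp => hoff p (hB p hp), hU, ?_, ?_, fun w hw => ?_⟩
  · rw [hV]; exact hne
  · rw [hU, hV]; exact hconj
  · rw [hU, hV]; exact hw.symm

/-- On `(ℤ/L)^2` the stack of the seams through the base point of `p₀` is `{p₀}`. [ours] -/
theorem stack_two_dim_iff (p₀ q : Plaquette 2 L) :
    (q.2.1.1 = 0 ∧ q.2.1.2 = 1 ∧ q.1 0 = p₀.1 0 ∧ q.1 1 = p₀.1 1) ↔ q = p₀ := by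
  constructor
  · rintro ⟨-, -, h0, h1⟩
    obtain ⟨hq0, hq1⟩ := Theory2.Lattice.Flux.plaquette_dirs_eq q
    obtain ⟨hp0, hp1⟩ := Theory2.Lattice.Flux.plaquette_dirs_eq p₀
    refine Prod.ext (funext fun m => ?_) (Subtype.ext (Prod.ext (by rw [hq0, hp0]) (by rw [hq1, hp1])))
    fin_cases m
    · exact h0
    · exact h1
  · intro h
    rw [h]
    exact ⟨(Theory2.Lattice.Flux.plaquette_dirs_eq p₀).1, (Theory2.Lattice.Flux.plaquette_dirs_eq p₀).2, rfl, rfl⟩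

/-- **In particular (`p₀ ∉ B` is all that is needed when `d = 2`): on `(ℤ/L)^2`, for every plaquette `p₀` and
every `B ∌ p₀`, the holonomies around `B` do not determine the holonomy — nor the conjugacy class, nor the
value of a class function separating `[a, b]` from `1` — around `p₀`, as soon as `G` has a non-commuting pair**
(seams through the base point of `p₀`; the stack is `{p₀}`). [ours] -/
theorem not_determined_two_dim {a b : G} (hab : a * b ≠ b * a) (p₀ : Plaquette 2 L) (B : Finset (Plaquette 2 L))
    (hB : p₀ ∉ B) :
    ∃ U V : GaugeConfig 2 L G,
      (∀ p ∈ B, plaquetteHolonomy U p.1 p.2.1.1 p.2.1.2 = plaquetteHolonomy V p.1 p.2.1.1 p.2.1.2) ∧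
      plaquetteHolonomy U p₀.1 p₀.2.1.1 p₀.2.1.2 = 1 ∧ plaquetteHolonomy V p₀.1 p₀.2.1.1 p₀.2.1.2 ≠ 1 ∧
      ¬ IsConj (plaquetteHolonomy U p₀.1 p₀.2.1.1 p₀.2.1.2) (plaquetteHolonomy V p₀.1 p₀.2.1.1 p₀.2.1.2) ∧
      ∀ w : G → ℝ, w (a * b * a⁻¹ * b⁻¹) ≠ w 1 →
        w (plaquetteHolonomy U p₀.1 p₀.2.1.1 p₀.2.1.2) ≠ w (plaquetteHolonomy V p₀.1 p₀.2.1.1 p₀.2.1.2) := by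
  refine not_determined_of_disjoint_stack hab (show (0 : Fin 2) < 1 by decide) (p₀.1 0) (p₀.1 1) B
    (fun p hp hmem => ?_) p₀ ((stack_two_dim_iff p₀ p₀).2 rfl)
  rw [(stack_two_dim_iff p₀ p).1 hmem] at hp
  exact hB hp

/-- **A LONE EXCITED PLAQUETTE** (`d = 2`, `G` with a non-commuting pair): for every `p₀` there is a
configuration with holonomy `1` around every other plaquette and `[a, b] ≠ 1` around `p₀` — the abelian
identity `∏_p U_p = 1` (`AbelianHolonomyDetermination.prod_plaquetteHolonomy_univ_eq_one`) has no
non-commutative analogue. [ours] -/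
theorem exists_lone_plaquette_two_dim {a b : G} (hab : a * b ≠ b * a) (p₀ : Plaquette 2 L) :
    ∃ V : GaugeConfig 2 L G, (∀ p : Plaquette 2 L, p ≠ p₀ → plaquetteHolonomy V p.1 p.2.1.1 p.2.1.2 = 1) ∧
      plaquetteHolonomy V p₀.1 p₀.2.1.1 p₀.2.1.2 = a * b * a⁻¹ * b⁻¹ ∧ a * b * a⁻¹ * b⁻¹ ≠ 1 := by
  refine ⟨fun e : Edge 2 L => if e.2 = 0 then (if e.1 0 = p₀.1 0 then a else 1)
      else if e.2 = 1 then (if e.1 1 = p₀.1 1 then b else 1) else 1, fun p hp => ?_, ?_,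
    (commutator_ne_one_not_isConj hab).1⟩
  · exact plaquetteHolonomy_twoSeam_eq_one a b (show (0 : Fin 2) < 1 by decide) _ _ p
      (fun h => hp ((stack_two_dim_iff p₀ p).1 h))
  · exact plaquetteHolonomy_twoSeam_eq_commutator a b (show (0 : Fin 2) < 1 by decide) _ _ p₀
      ((stack_two_dim_iff p₀ p₀).2 rfl)

/-- **Contrast: for a COMMUTATIVE gauge group there is no lone excited plaquette, in any dimension** — if every
plaquette but `p₀` has holonomy `1`, so has `p₀` (`U_{p₀} = (∏_{p≠p₀} U_p)⁻¹`). [ours] -/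
theorem no_lone_plaquette_of_comm [NeZero L] {H : Type*} [CommGroup H] (V : GaugeConfig d L H)
    (p₀ : Plaquette d L) (h : ∀ p : Plaquette d L, p ≠ p₀ → plaquetteHolonomy V p.1 p.2.1.1 p.2.1.2 = 1) :
    plaquetteHolonomy V p₀.1 p₀.2.1.1 p₀.2.1.2 = 1 := by
  classical
  rw [plaquetteHolonomy_eq_inv_prod_erase_anyDim V p₀, Finset.prod_eq_one fun p hp => h p
    (Finset.ne_of_mem_erase hp), inv_one]

end Summit.Ventures.LatticeQCDFlow.Theory2.Autoregressive
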